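import Literature.NumberTheory.EllipticCurves.CasselsTateLevelInputs
import Literature.NumberTheory.EllipticCurves.CasselsTateSelfPairing
import Literature.NumberTheory.GaloisCohomology.ArchimedeanInvariantMap
import Literature.NumberTheory.GaloisCohomology.PoitouTateNumberField
import HarnessLib

/-!
# The levelwise Cassels–Tate inputs FOR THE CANONICAL FAMILY of local invariant maps: what separates the
# tree from `casselsTate_levelInputs_holds`

`Proofs` file (theorems only: no definition, no named fact, no `sorry`) for the named fact
`Literature.NumberTheory.EllipticCurves.casselsTate_levelInputs K` (`CasselsTateLevelInputs.lean`, cell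
`bsd-stepL`, 2026-08-27: Milne, *ADT* I §6 + local class field theory + Poitou–Tate, levelwise `∃ inv`).

The fact asserts, per datum `(E = W/ℚ, q = p^{M₀} odd, c ∈ Aut(K/ℚ) an involution, e a Weil-type pairing on
E[q²])`, the EXISTENCE of a family `inv : LocalInvariants K q²` with five properties (i)–(v).  Its module
docstring records «the tree has no local class field theory: `LocalInvariants` is a bare family … size XL; no
`_holds` is attempted».  Since then the tree has acquired THE family of invariant maps of the global class
formation, `LocalInvariants.canonical K n` (`GaloisCohomology/ArchimedeanInvariantMap.lean`: the residue maps
`localInvariantMap K n v` of local class field theory at the finite places, the archimedean invariant maps at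
the infinite ones), together with KERNEL proofs of two of the five conjuncts for it:

* (i) the reciprocity law `∑_v inv_v (loc_v c) = 0` on `H²(K, μₙ)` — `sumInvLocalizationEqZero_canonical_of_numberField`
  (`GaloisCohomology/PoitouTateNumberField.lean`, Tate, Cassels–Fröhlich VII §11; every number field `K : Type`, every `n`);
* (ii) local Tate duality at the finite places — `LocalInvariants.canonical_isPerfect` (Milne I Cor. 2.3, via
  `localInvariantMap_bijective`).

This file pins `inv := LocalInvariants.canonical K q²` in the fact and records the EXACT residual as displayed
hypotheses — the theorem `casselsTate_levelInputs_of_canonical_inputs`: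

* `hH3` — (iii) `Ш³(K, μₙ) = 0`: a class of `H³(K, μₙ)` vanishing at every place is `0` (Milne I Thm. 4.10(c):
  `β³ : H³(G_S, M) ⥲ ⊕_{v real} H³(K_v, M)`);
* `hPTc` — the Poitou–Tate vanishing criterion for `Ш²(K, E[q])` in cochain form (Milne I Thm. 4.10(a)), and
  `h615` — the conclusion of Milne's Lemma 6.15 for all finite `S ⊇ S₀`: the two displayed inputs of the tree's
  `isLevelPairing_ctLevelPairing_of_inputs` (`CasselsTateFiniteSupport.lean`), which turn Milne's Prop. 6.9 recipe
  `ctLevelPairing` into a LEVEL pairing on `Ш(E/K)[q]` (conjunct (iv)); the alternation input of that theorem is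
  PROVED for odd `q` (`ctGeneralFun_self_eq_zero_of_odd`, Cassels 1962 / Milne I Rem. 6.10–6.11) and its
  finite-support input is PROVED (`localTerm_finite_support`), so neither appears here;
* `hconj` — (v) the invariance of the general-case value `ctGeneralFun` on the `q²`-Selmer group under the action
  `conjAct W c` of the involution `c` (Gross 1991 §5 (5.1); McCallum 1991 §5), for the canonical family.

So `casselsTate_levelInputs K` (hence the binder `hCT`/`hCTf` of the `p = 3` Shimura–Kolyvagin consumers and of
McCallum's Cor. 5.6 upper form `…_of_casselsTate_of_frobeniusCongruence_of_E0`) follows from {(iii), 4.10(a) in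
cochain form, Lemma 6.15, (v)} for ONE pinned family — parallel to the tree's reduction of
`poitouTate_selmerStructure_duality_conj` to {`UnramifiedOrthogonal`, `SelmerComplement`} for the same family
(`poitouTate_selmerStructure_duality_conj_of_canonical_numberField`).  Nothing here is new mathematics; no curve-
or prime-specific statement is proved; BSD is not advanced.  Width seat `bsd-wall-soed-p2-w2` g2 (route
`SemiOrdinaryEisensteinDescent`, crux Ko stmt-BirchSwinnertonDyer-20480, whose line `birth` v3 carries
`∀ K, casselsTate_levelInputs K` inside its print stub `stub_inputsPrim`).

## References

* [MilneADT2006] J. S. Milne, *Arithmetic Duality Theorems*, 2nd ed. (2006), Ch. I: Cor. 2.3, Thm. 4.10 (a)(c),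
  §6 Prop. 6.9, Thm. 6.13 (a)(b), Lemma 6.15, Lemma 6.17, Rem. 6.10–6.11.
* [CasselsFrohlichANT1967] J. Tate, *Global class field theory*, in Cassels–Fröhlich (1967), Ch. VII §11.
* [Cassels1962ArithmeticIV] J. W. S. Cassels, *Arithmetic on curves of genus 1. IV. Proof of the
  Hauptvermutung*, J. reine angew. Math. 211 (1962).
* [GrossLMS1991] B. H. Gross, *Kolyvagin's work on modular elliptic curves* (1991), §5 (5.1).
* [McCallumLMS1991] W. G. McCallum, *Kolyvagin's work on Shafarevich–Tate groups* (1991), §5, Thms. 5.4, 5.8.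
-/

noncomputable section

open scoped Classical

namespace Literature.NumberTheory.EllipticCurves

open _root_.WeierstrassCurve Field NumberField IsDedekindDomain Function
  Literature.NumberTheory.GaloisRepresentations Literature.NumberTheory.GaloisCohomology
  Literature.GroupTheory.FiniteAbelian
open Literature.NumberTheory.GaloisRepresentations.DiscreteGaloisModule (mu MuCarrier)

/-- **`casselsTate_levelInputs K` from its residual inputs FOR THE CANONICAL FAMILY of invariant maps.**
Take `inv := LocalInvariants.canonical K (q·q)` (`q = p^{M₀}`): conjunct (i) (reciprocity on `H²(K, μ_{q²})`) is
`sumInvLocalizationEqZero_canonical_of_numberField`, conjunct (ii) (local Tate duality) is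
`LocalInvariants.canonical_isPerfect`; conjunct (iv) (`ctLevelPairing` is a level pairing on `Ш(E/K)[q]`) is the
tree's `isLevelPairing_ctLevelPairing_of_inputs` fed with the displayed `hPTc` (Milne I 4.10(a), cochain form)
and `h615` (Milne I Lemma 6.15 for all `S ⊇ S₀`), its alternation input being `ctGeneralFun_self_eq_zero_of_odd`
(`q` odd as `p ≠ 2`) and its finite-support input `localTerm_finite_support`; conjuncts (iii) `Ш³(K, μ_{q²}) = 0`
and (v) (`conjAct`-invariance of `ctGeneralFun` on the `q²`-Selmer group) are the displayed `hH3`, `hconj`.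
CONDITIONAL on the four displayed hypotheses; nothing else is asserted.
[cite: MilneADT2006, Ch. I Cor. 2.3, Thm. 4.10(a)(c), §6 Prop. 6.9, Thm. 6.13(a)(b), Lemma 6.15]
[cite: CasselsFrohlichANT1967, Ch. VII §11] [cite: GrossLMS1991, §5 (5.1)] [cite: McCallumLMS1991, §5, Thm. 5.4, Thm. 5.8] -/
theorem casselsTate_levelInputs_of_canonical_inputs (K : Type) [Field K] [NumberField K]
    (hH3 : ∀ (n : ℕ) [NeZero n] (x : galoisCohomology (mu K n) 3),
      (∀ v : Place K, galoisCohomology.localization (mu K n) v 3 x = 0) → x = 0)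
    (hPTc : ∀ (W : WeierstrassCurve ℚ) [W.IsElliptic] (p M₀ : ℕ), p.Prime → p ≠ 2 → 1 ≤ M₀ →
      ∀ [NeZero (p ^ M₀)]
        (e : geomTorsion (W.baseChange K) ((p ^ M₀ * p ^ M₀ : ℕ) : ℤ) →
          geomTorsion (W.baseChange K) ((p ^ M₀ * p ^ M₀ : ℕ) : ℤ) → AlgebraicClosure K)
        (hμ : ∀ S T, e S T ^ (p ^ M₀ * p ^ M₀) = 1)
        (hadd₁ : ∀ S₁ S₂ T, e (S₁ + S₂) T = e S₁ T * e S₂ T)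
        (hadd₂ : ∀ S T₁ T₂, e S (T₁ + T₂) = e S T₁ * e S T₂)
        (hgal : ∀ (σ : absoluteGaloisGroup K)
          (S T : geomTorsion (W.baseChange K) ((p ^ M₀ * p ^ M₀ : ℕ) : ℤ)), σ • e S T = e (σ • S) (σ • T)),
        (∀ T, e T T = 1) → (∀ T, (∀ S, e S T = 1) → T = 0) →
        ∀ f : contTwoCocycles ((W.baseChange K).torsionGaloisModule ((p ^ M₀ : ℕ) : ℤ)).toTopRep,
          (∀ g : contOneCocycles ((W.baseChange K).torsionGaloisModule ((p ^ M₀ : ℕ) : ℤ)).toTopRep,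
            (∀ v : Place K, locClass ((W.baseChange K).torsionGaloisModule ((p ^ M₀ : ℕ) : ℤ))
                (Place.Completion v)
                (resOne ((W.baseChange K).torsionGaloisModule ((p ^ M₀ : ℕ) : ℤ)) (Place.Completion v) g) = 0) →
            ∃ (C : PTChoice (W.baseChange K) (p ^ M₀) e hμ hadd₁ hadd₂ hgal f g) (S : Finset (Place K)),
              (∀ v ∉ S, C.localTerm (LocalInvariants.canonical K (p ^ M₀ * p ^ M₀)) v = 0) ∧
                ∑ v ∈ S, C.localTerm (LocalInvariants.canonical K (p ^ M₀ * p ^ M₀)) v = 0) →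
          twoCocycleClass _ f = 0)
    (h615 : ∀ (W : WeierstrassCurve ℚ) [W.IsElliptic] (p M₀ : ℕ), p.Prime → p ≠ 2 → 1 ≤ M₀ →
      ∀ [NeZero (p ^ M₀)]
        (e : geomTorsion (W.baseChange K) ((p ^ M₀ * p ^ M₀ : ℕ) : ℤ) →
          geomTorsion (W.baseChange K) ((p ^ M₀ * p ^ M₀ : ℕ) : ℤ) → AlgebraicClosure K)
        (hμ : ∀ S T, e S T ^ (p ^ M₀ * p ^ M₀) = 1)
        (hadd₁ : ∀ S₁ S₂ T, e (S₁ + S₂) T = e S₁ T * e S₂ T)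
        (hadd₂ : ∀ S T₁ T₂, e S (T₁ + T₂) = e S T₁ * e S T₂)
        (hgal : ∀ (σ : absoluteGaloisGroup K)
          (S T : geomTorsion (W.baseChange K) ((p ^ M₀ * p ^ M₀ : ℕ) : ℤ)), σ • e S T = e (σ • S) (σ • T)),
        (∀ T, e T T = 1) → (∀ T, (∀ S, e S T = 1) → T = 0) →
        ∃ S₀ : Finset (Place K), ∀ S : Finset (Place K), S₀ ⊆ S →
          ∀ x : LocalClasses (W.baseChange K) (p ^ M₀) S,
            (∀ b' ∈ selmerGroup (W.baseChange K) ((p ^ M₀ : ℕ) : ℤ),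
              sumPairing (W.baseChange K) (p ^ M₀) e hμ hadd₁ hadd₂ hgal
                (LocalInvariants.canonical K (p ^ M₀ * p ^ M₀)) S x (locS (W.baseChange K) (p ^ M₀) S b') = 0) →
            ∃ b₀ ∈ kummerOutside (W.baseChange K) (p ^ M₀) S, ∀ v : S,
              x v - locS (W.baseChange K) (p ^ M₀) S b₀ v ∈
                (W.baseChange K).kummerLocalConditionAt ((p ^ M₀ : ℕ) : ℤ) (Place.Completion (v : Place K)))
    (hconj : ∀ (W : WeierstrassCurve ℚ) [W.IsElliptic] (p M₀ : ℕ), p.Prime → p ≠ 2 → 1 ≤ M₀ →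
      ∀ [NeZero (p ^ M₀)] (c : K ≃ₐ[ℚ] K), c ≠ 1 → c * c = 1 →
      ∀ (e : geomTorsion (W.baseChange K) ((p ^ M₀ * p ^ M₀ : ℕ) : ℤ) →
          geomTorsion (W.baseChange K) ((p ^ M₀ * p ^ M₀ : ℕ) : ℤ) → AlgebraicClosure K)
        (hμ : ∀ S T, e S T ^ (p ^ M₀ * p ^ M₀) = 1)
        (hadd₁ : ∀ S₁ S₂ T, e (S₁ + S₂) T = e S₁ T * e S₂ T)
        (hadd₂ : ∀ S T₁ T₂, e S (T₁ + T₂) = e S T₁ * e S T₂)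
        (hgal : ∀ (σ : absoluteGaloisGroup K)
          (S T : geomTorsion (W.baseChange K) ((p ^ M₀ * p ^ M₀ : ℕ) : ℤ)), σ • e S T = e (σ • S) (σ • T)),
        (∀ T, e T T = 1) → (∀ T, (∀ S, e S T = 1) → T = 0) →
        ∀ z ∈ selmerGroup (W.baseChange K) ((p ^ M₀ * p ^ M₀ : ℕ) : ℤ),
          ∀ t ∈ selmerGroup (W.baseChange K) ((p ^ M₀ * p ^ M₀ : ℕ) : ℤ),
          ctGeneralFun (W.baseChange K) (p ^ M₀) e hμ hadd₁ hadd₂ hgal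
              (LocalInvariants.canonical K (p ^ M₀ * p ^ M₀))
              (torsionH1ToH1 (W.baseChange K) _ (conjAct W c _ z))
              (torsionH1ToH1 (W.baseChange K) _ (conjAct W c _ t)) =
            ctGeneralFun (W.baseChange K) (p ^ M₀) e hμ hadd₁ hadd₂ hgal
              (LocalInvariants.canonical K (p ^ M₀ * p ^ M₀))
              (torsionH1ToH1 (W.baseChange K) _ z) (torsionH1ToH1 (W.baseChange K) _ t)) :
    casselsTate_levelInputs K := by
  intro W _ p M₀ hp hp2 hM₀ _ c hc hcc e hμ hadd₁ hadd₂ hgal halt hnd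
  have hPT' : (LocalInvariants.canonical K (p ^ M₀ * p ^ M₀)).SumInvLocalizationEqZero :=
    sumInvLocalizationEqZero_canonical_of_numberField K _
  have hodd : Odd (p ^ M₀) := (hp.odd_of_ne_two hp2).pow
  obtain ⟨S₀, h615'⟩ := h615 W p M₀ hp hp2 hM₀ e hμ hadd₁ hadd₂ hgal halt hnd
  refine ⟨LocalInvariants.canonical K (p ^ M₀ * p ^ M₀), hPT', hH3 _, LocalInvariants.canonical_isPerfect, ?_,
    hconj W p M₀ hp hp2 hM₀ c hc hcc e hμ hadd₁ hadd₂ hgal halt hnd⟩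
  exact isLevelPairing_ctLevelPairing_of_inputs (W.baseChange K) (p ^ M₀) e hμ hadd₁ hadd₂ hgal
    (LocalInvariants.canonical K (p ^ M₀ * p ^ M₀)) halt hPT' (hH3 _)
    (hPTc W p M₀ hp hp2 hM₀ e hμ hadd₁ hadd₂ hgal halt hnd) S₀ h615'
    (fun a ha hma ↦ ctGeneralFun_self_eq_zero_of_odd (LocalInvariants.canonical K (p ^ M₀ * p ^ M₀)) halt hPT'
      (hH3 _) (localTerm_finite_support (W.baseChange K) (p ^ M₀) e hμ hadd₁ hadd₂ hgal halt _) hodd ha hma)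

end Literature.NumberTheory.EllipticCurves

end
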